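import Mathlib
import Summits.ValiantsHypothesis.ValiantsHypothesis.Theses.FeketeSOS
import Summits.ValiantsHypothesis.ValiantsHypothesis.Theorems.FeketeSOSDepthZeroShadow
import Summits.ValiantsHypothesis.ValiantsHypothesis.Theorems.FeketeSOSSublinearShadowEvalSupport
import Summits.ValiantsHypothesis.ValiantsHypothesis.Theorems.FeketeSOSSublinearShadowWindowDFT
import Summits.ValiantsHypothesis.ValiantsHypothesis.Theorems.FeketeSOSSublinearShadowPrimRoot
import Summits.ValiantsHypothesis.ValiantsHypothesis.Theorems.FeketeSOSSublinearShadowReindex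

/-!
# `FeketeSOS.SublinearShadow` (stmt-ValiantsHypothesis-14990), line `Sketch` — the WINDOW REDUCTION

`shadow_of_window` (pointwise): over an algebraically closed field `K` of characteristic `p`, a WINDOW MODEL of
order `v` on supports `S_i` — weights `γ_i ∈ K[Π]` and digit expansions `Y_i ∈ K[X][Π]` of `Π`-degree `≤ v` whose
`X`-digits are supported inside `S_i`, with `Π^v`-layer of `Σ_i γ_i Y_i²` equal to `u₀ · F̄_p`, `u₀ ≠ 0` — yields
a cyclic characteristic-`p` representation of `F̄_p` with `d ≤ (2v+2)·s` squares of degree `< p` and total support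
`≤ (2v+2)·Σ|S_i|`.  Proof = composition of the line's landed stubs: a primitive `m`-th root of unity with
`2v < m ≤ 2v+2`, `p ∤ m` (`stub_primRoot`); DFT extraction of the `Π^v`-layer as `m·s` honest weighted squares
`Y_i(ζ^k, X)²` (`stub_windowDFT`, Bini 1980 / Bürgisser–Clausen–Shokrollahi Prop. 15.26); digits stay on the
support (`stub_evalSupport`); reindexing over `Fin (m·s)` (`stub_reindex`); cyclic folding `X^n ↦ X^{n mod p}`
(`dzs_*` of `Theorems/FeketeSOSDepthZeroShadow.lean`).

`sublinearShadow_of_orderBudget`: hence the crux `SublinearShadow` follows from the ORDER BUDGET of the line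
(cards `window-dft-debordering` / `frobenius-window-extraction`, Cruxes/SublinearShadow; stated inline as a
hypothesis — it is the open core of the crux, not a published fact): every sublinear complex representation admits
a window model of order `v` with `2v + 2 ≤ (s+1)^B` on its own supports.  Constants: `A = B + 1`.
-/

namespace Summit.ValiantsHypothesis.ValiantsHypothesis.Theorems.SublinearShadowSketch

open Polynomial Finset
open scoped BigOperators

-- `Summit.ValiantsHypothesis.ValiantsHypothesis.…` is the tree's mandated single-conjunct layout (Sub = Summit).
set_option linter.dupNamespace false

/-- **Window ⇒ shadow (pointwise window reduction).**  A window model of order `v` of `F̄_p` on supports `S_i`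
over an algebraically closed field of characteristic `p` gives a cyclic representation of `F̄_p` with
`d ≤ (2v+2)·s` squares of degree `< p` and total support `≤ (2v+2)·Σ_i |S_i|`. -/
theorem shadow_of_window : ∀ (p : ℕ) [Fact p.Prime] (K : Type) [Field K] [CharP K p] [IsAlgClosed K] (s v : ℕ) (S : Fin s → Finset ℕ) (γ : Fin s → Polynomial K) (Y : Fin s → Polynomial (Polynomial K)) (u₀ : K), u₀ ≠ 0 → (∀ i, (γ i).natDegree ≤ v) → (∀ i, (Y i).natDegree ≤ v) → (∀ i n, ((Y i).coeff n).support ⊆ S i) → (∑ i, (γ i).map (Polynomial.C : K →+* Polynomial K) * Y i ^ 2).coeff v = Polynomial.C u₀ * ∑ m ∈ Finset.range p, Polynomial.C ((legendreSym p m : ℤ) : K) * Polynomial.X ^ m → ∃ (d : ℕ) (c' : Fin d → K) (g' : Fin d → Polynomial K), d ≤ (2 * v + 2) * s ∧ (∀ j, (g' j).natDegree < p) ∧ (∑ j, (g' j).support.card) ≤ (2 * v + 2) * ∑ i, (S i).card ∧ ((Polynomial.X : Polynomial K) ^ p - 1 ∣ (∑ j, Polynomial.C (c' j) * g' j ^ 2)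 - ∑ m ∈ Finset.range p, Polynomial.C ((legendreSym p m : ℤ) : K) * Polynomial.X ^ m) := by
  intro p _ K _ _ _ s v S γ Y u₀ hu hγ hY hsupp hlayer
  classical
  have hprime : p.Prime := Fact.out
  have hp0 : 0 < p := hprime.pos
  set F : Polynomial K := ∑ m ∈ Finset.range p, Polynomial.C ((legendreSym p m : ℤ) : K) * Polynomial.X ^ m
    with hF
  -- a primitive `m`-th root of unity, `2v < m ≤ 2v + 2`, `p ∤ m`
  obtain ⟨m, ζ, hm1, hm2, hmK, hζ⟩ := stub_primRoot p K v
  -- DFT extraction of the `Π^v`-layer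
  have hFeq := stub_windowDFT K s v m ζ hζ hm1 hmK γ Y hγ hY F u₀ hu hlayer
  obtain ⟨a, ha⟩ : ∃ a : ℕ → Fin s → K,
      ∀ k i, a k i = (u₀ * (m : K))⁻¹ * (ζ ^ k)⁻¹ ^ v * (γ i).eval (ζ ^ k) := ⟨_, fun _ _ => rfl⟩
  obtain ⟨P, hP⟩ : ∃ P : ℕ → Fin s → Polynomial K,
      ∀ k i, P k i = (Y i).eval (Polynomial.C (ζ ^ k)) := ⟨_, fun _ _ => rfl⟩
  have hFeq' : F = ∑ k ∈ range m, ∑ i, Polynomial.C (a k i) * P k i ^ 2 := by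
    simp only [ha, hP]; exact hFeq
  -- reindex over `Fin (m * s)`
  obtain ⟨c', g', hcard, hsum⟩ := stub_reindex K m s a P
  -- fold exponents modulo `p`
  obtain ⟨g'', hg''⟩ : ∃ g'' : Fin (m * s) → Polynomial K,
      ∀ j, g'' j = ∑ n ∈ (g' j).support, Polynomial.C ((g' j).coeff n) * Polynomial.X ^ (n % p) :=
    ⟨_, fun _ => rfl⟩
  refine ⟨m * s, c', g'', Nat.mul_le_mul_right s hm2, ?_, ?_, ?_⟩
  · -- degrees
    intro j; rw [hg'' j]; exact dzs_natDegree_fold_lt (g' j) hp0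
  · -- total support
    calc ∑ j, (g'' j).support.card
        ≤ ∑ j, (g' j).support.card :=
          Finset.sum_le_sum fun j _ => by rw [hg'' j]; exact dzs_card_support_fold_le _ _
      _ = ∑ k ∈ range m, ∑ i, (P k i).support.card := hcard
      _ ≤ ∑ k ∈ range m, ∑ i, (S i).card :=
          Finset.sum_le_sum fun k _ => Finset.sum_le_sum fun i _ => by
            rw [hP k i]
            exact Finset.card_le_card (stub_evalSupport K (Y i) (S i) (ζ ^ k) (hsupp i))
      _ = m * ∑ i, (S i).card := by
          rw [Finset.sum_const, Finset.card_range, smul_eq_mul]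
      _ ≤ (2 * v + 2) * ∑ i, (S i).card := Nat.mul_le_mul_right _ hm2
  · -- the cyclic identity
    have hrep' : ∑ j, Polynomial.C (c' j) * g' j ^ 2 = F := by rw [hsum]; exact hFeq'.symm
    exact dzs_dvd_sum_sq_sub c' g' g'' F hrep'
      (fun j => by rw [hg'' j]; exact dzs_X_pow_sub_one_dvd_fold_sub (g' j) p)

/-- **ORDER BUDGET ⇒ crux** (`A = B + 1`): if every sublinear complex representation of `F_p` (`p` large) has a
window model of order `v` with `2v + 2 ≤ (s+1)^B` on its own supports, then `FeketeSOS.SublinearShadow` holds. -/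
theorem sublinearShadow_of_orderBudget
    (hOB : ∃ B p₁ : ℕ, ∀ (p : ℕ) [Fact p.Prime], p₁ ≤ p → ∀ (s : ℕ) (c : Fin s → ℂ) (g : Fin s → Polynomial ℂ),
      (∀ i, (g i).natDegree ≤ p ^ 2) → (∑ i, (g i).support.card) ^ 4 ≤ p ^ 3 →
      (∑ i, Polynomial.C (c i) * g i ^ 2)
        = ∑ m ∈ Finset.range p, Polynomial.C ((legendreSym p m : ℤ) : ℂ) * Polynomial.X ^ m →
      ∃ (v : ℕ) (K : Type) (_ : Field K) (_ : CharP K p) (_ : IsAlgClosed K)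
        (γ : Fin s → Polynomial K) (Y : Fin s → Polynomial (Polynomial K)) (u₀ : K),
        2 * v + 2 ≤ (s + 1) ^ B ∧ u₀ ≠ 0 ∧ (∀ i, (γ i).natDegree ≤ v) ∧ (∀ i, (Y i).natDegree ≤ v) ∧
        (∀ i n, ((Y i).coeff n).support ⊆ (g i).support) ∧
        (∑ i, (γ i).map (Polynomial.C : K →+* Polynomial K) * Y i ^ 2).coeff v
          = Polynomial.C u₀ * ∑ m ∈ Finset.range p, Polynomial.C ((legendreSym p m : ℤ) : K) * Polynomial.X ^ m) :
    Summit.ValiantsHypothesis.ValiantsHypothesis.Theses.FeketeSOS.SublinearShadow := by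
  unfold Summit.ValiantsHypothesis.ValiantsHypothesis.Theses.FeketeSOS.SublinearShadow
  obtain ⟨B, p₁, H⟩ := hOB
  refine ⟨B + 1, p₁, ?_⟩
  intro p _ hp s c g hdeg hS hrep
  obtain ⟨v, K, instF, instC, instA, γ, Y, u₀, hv, hu, hγ, hY, hsupp, hlayer⟩ := H p hp s c g hdeg hS hrep
  obtain ⟨d, c', g', hd, hdeg', hcard, hdvd⟩ :=
    shadow_of_window p K s v (fun i => (g i).support) γ Y u₀ hu hγ hY hsupp hlayer
  refine ⟨K, instF, instC, d, c', g', ?_, hdeg', ?_, hdvd⟩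
  · calc d ≤ (2 * v + 2) * s := hd
      _ ≤ (s + 1) ^ B * (s + 1) := Nat.mul_le_mul hv (Nat.le_succ s)
      _ = (s + 1) ^ (B + 1) := (pow_succ _ _).symm
  · calc ∑ j, (g' j).support.card ≤ (2 * v + 2) * ∑ i, (g i).support.card := hcard
      _ ≤ (s + 1) ^ B * ∑ i, (g i).support.card := Nat.mul_le_mul_right _ hv
      _ ≤ (s + 1) ^ (B + 1) * ∑ i, (g i).support.card :=
          Nat.mul_le_mul_right _ (Nat.pow_le_pow_right (Nat.succ_pos s) (Nat.le_succ B))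

end Summit.ValiantsHypothesis.ValiantsHypothesis.Theorems.SublinearShadowSketch
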